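import Summits.ABC.StewartYu.PadicG3TwoThirdLiouville
import Summits.ABC.StewartYu.PadicG3TwoSlabKStep
import HarnessLib

/-!
# Cell abc-stewartyu, Gen-3 frame at `p = 2` (crux `Y07Two`, stmt-ABC-19659), F5 brick 4: SMALLNESS AT THE THIRD
# POINTS from the slab extrapolation, and the class sums' vanishing from one record inequality

`Summits/ABC/StewartYu/PadicG3TwoThirdSmall.lean` — cell `abc-stewartyu` (HOME `run/shared/lean/pub/abc-stewartyu/`),
route `PadicPrimesKummerThird`, seat p3 (g5), F-two LEAD; fourth brick of F5.

The third points `s/3` (`s ∈ ℤ`) have `‖s/3‖₂ ≤ 1`, so the slab extrapolation bound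
`PadicG3TwoSlabKStep.norm_g3G_le_of_zeros` (zeros of `g3φ` at `|x| ≤ N`, `|τ''| < Tlo`) applies AT `z = s/3`:
`‖φ_τ(s/3)‖ ≤ max (Bw·‖Λ₀‖·2ᵗ·2^{condExp 2 (2N+1) t}) (Bw/(4·2^m)^{(2N+1)t})` for `|τ| + t ≤ Tlo`
(`norm_g3Φ_third_le`).  With the third-point Liouville step (`thirdVec_eq_zero_of_norm_lt`) this gives
`thirdVec_eq_zero_of_zeros`: vanishing at the integers + ONE record inequality
`max(…) < 1/(6·D·M·P(all)⁵)^{3^{d+2}−1}` ⇒ all triadic class sums at `(τ, s)` vanish (Yu 2013 Lemma 5.3).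

WHAT THIS IS NOT: no sizes `D`, `M`; no re-indexing (bricks 5–7, memo-09 §13); no crux moves.

References: K. Yu, Acta Math. 211 (2013), Lemma 5.3; K. Yu, Compositio Math. 74 (1990), §3.
-/

noncomputable section

open Finset NormedSpace
open Literature.NumberTheory.Transcendental
open Literature.NumberTheory.Transcendental.CW77 (heightProd)
open Literature.NumberTheory.Transcendental.CW77.Setup (Tau tauNorm)
open Literature.NumberTheory.Transcendental.PadicCW77 (condExp)

namespace Summit.ABC.StewartYu

namespace TwoSetup

variable (S : TwoSetup) {ι : Type*} (R : ι → Polynomial ℚ) (u : ι → Fin S.d → ℤ) (uθ : ι → ℤ)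

/-- `‖s/3‖₂ ≤ 1` for every integer `s`. [folklore] -/
theorem norm_intCast_mul_inv_three_le (s : ℤ) : ‖(s : ℚ_[2]) * ((3 : ℕ) : ℚ_[2])⁻¹‖ ≤ 1 := by
  haveI : Fact (Nat.Prime 2) := ⟨Nat.prime_two⟩
  rw [norm_mul, TwoAdic.norm_inv_three_two, mul_one]
  exact Padic.norm_int_le_one (p := 2) s

/-- **Smallness of `φ_τ` at the third points** from the zeros at the integers (slab extrapolation at `z = s/3`).
[cite: Yu2013, Lemma 5.3 with Lemma 5.2] -/
theorem norm_g3Φ_third_le (B : Finset ι) (p : ι → ℤ) (i₀ : ι) {m : ℕ}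
    (hslab : ∀ i ∈ B, ‖S.δexpo u uθ i₀ i‖ ≤ ((2 : ℝ) ^ (m + 3))⁻¹) {N Tlo t : ℕ} (ht : 1 ≤ t)
    {Bw : ℝ} (hBw0 : 0 ≤ Bw) (hBw : ∀ i ∈ B, ∀ t₀ k, ‖(hw R i t₀).coeff k‖ * (4 * (2 : ℝ) ^ m) ^ k ≤ Bw)
    (hzero : ∀ x : ℤ, |x| ≤ (N : ℤ) → ∀ τ'' : Tau S.d, tauNorm τ'' < Tlo →
      S.g3φ R u uθ B p τ'' x = 0)
    (s : ℤ) (τ : Tau S.d) (hτ : tauNorm τ + t ≤ Tlo) :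
    ‖S.g3Φ R u uθ B p τ ((s : ℚ_[2]) * ((3 : ℕ) : ℚ_[2])⁻¹)‖ ≤
      max (Bw * ‖S.Λ₀‖ * (2 : ℝ) ^ t * (2 : ℝ) ^ condExp 2 (2 * N + 1) t)
        (Bw / (4 * (2 : ℝ) ^ m) ^ ((2 * N + 1) * t)) :=
  (S.norm_g3G_le_of_zeros R u uθ B p i₀ hslab ht hBw0 hBw hzero (norm_intCast_mul_inv_three_le s) τ hτ).2

/-- **The class sums vanish from the zeros at the integers and ONE record inequality**: zeros of `g3φ` at
`|x| ≤ N`, `|τ''| < Tlo` (slab family), `|τ| + t ≤ Tlo`, denominators `D` / `ℓ¹`-bound `M` of `thirdVec B p τ s`,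
and `max(…) < 1/(6·D·M·P(all)⁵)^{3^{d+2}−1}` ⇒ `thirdVec B p τ s = 0`. [cite: Yu2013, Lemma 5.3] -/
theorem thirdVec_eq_zero_of_zeros
    (hK : ∀ κ : Fin (S.d + 1) → ℕ, (∃ j, ¬ 3 ∣ κ j) → ∀ γ : ℚ, ∏ j, S.toQ.all j ^ κ j ≠ γ ^ 3)
    (B : Finset ι) (p : ι → ℤ) (i₀ : ι) {m : ℕ}
    (hslab : ∀ i ∈ B, ‖S.δexpo u uθ i₀ i‖ ≤ ((2 : ℝ) ^ (m + 3))⁻¹) {N Tlo t : ℕ} (ht : 1 ≤ t)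
    {Bw : ℝ} (hBw0 : 0 ≤ Bw) (hBw : ∀ i ∈ B, ∀ t₀ k, ‖(hw R i t₀).coeff k‖ * (4 * (2 : ℝ) ^ m) ^ k ≤ Bw)
    (hzero : ∀ x : ℤ, |x| ≤ (N : ℤ) → ∀ τ'' : Tau S.d, tauNorm τ'' < Tlo →
      S.g3φ R u uθ B p τ'' x = 0)
    (s : ℤ) (τ : Tau S.d) (hτ : tauNorm τ + t ≤ Tlo)
    {D : ℕ} (hD : 1 ≤ D) (hden : ∀ r, ∃ z : ℤ, (D : ℚ) * S.thirdVec R u uθ B p τ s r = z)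
    {M : ℝ} (hM : 1 ≤ M) (hcM : ∑ r, |(S.thirdVec R u uθ B p τ s r : ℝ)| ≤ M)
    (hfinal : max (Bw * ‖S.Λ₀‖ * (2 : ℝ) ^ t * (2 : ℝ) ^ condExp 2 (2 * N + 1) t)
        (Bw / (4 * (2 : ℝ) ^ m) ^ ((2 * N + 1) * t)) <
      1 / (6 * (D : ℝ) * M * heightProd S.toQ.all ^ 5) ^ (3 ^ (S.d + 1 + 1) - 1)) :
    S.thirdVec R u uθ B p τ s = 0 :=
  S.thirdVec_eq_zero_of_norm_lt R u uθ hK B p τ s hD hden hM hcM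
    (lt_of_le_of_lt (S.norm_g3Φ_third_le R u uθ B p i₀ hslab ht hBw0 hBw hzero s τ hτ) hfinal)

end TwoSetup

end Summit.ABC.StewartYu

end
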